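import Mathlib.Analysis.Convex.Join
import Literature.Probability.Percolation.SmirnovDiscreteCauchy

/-!
# Route CardyBondTriangular — the faces inside a lattice triangular contour, as faces of `δ𝕋`

Support of the informal route item `SwitchingReduction` (stmt-CriticalPhenomena-5004), geometric
part. Bollobás–Riordan's summation by parts (*Percolation* (2006), Ch. 7, Lemma 13, p. 181) runs
over `C°`, "the set of vertices of `δH` in the interior of" a lattice triangular contour `C`; the
tree books `C°` in local coordinates (`localInterior n`, `localToHex`/`localToHexNeg` of
`SmirnovDiscreteCauchy`) and proves that the faces of `C°` have their vertices in the closed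
solid triangle (`triMeshPoint_mem_convexHull_localToHex(Neg)`). The route's crux
`MesoscopicColourSwitching` indexes the same faces intrinsically — the faces of `δ𝕋` all of whose
vertices lie in the closed solid triangle — so the converse is needed: every such face is a face
of `C°` (`exists_localToHex_of_vertices`, `exists_localToHexNeg_of_vertices`, for both signs of
the mesh), through the lattice coordinates of a site of the solid triangle
(`coords_of_triMeshPoint_mem_convexHull`: `σA, σB ≥ 0`, `σ(A + B) ≤ n`) read off the unique
barycentric representation (`exists_coeffs_of_mem_convexHull_triple`). With the injectivity of
the local face maps (`localToHex_injective`, `localToHexNeg_injective`) this identifies `C°`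
with the vertex-guarded faces as finite sets (used in `CardyBondTriangularSwitchingReductionSigned`).

## References

* B. Bollobás, O. Riordan, *Percolation*, Cambridge University Press (2006), Ch. 7, Lemma 13
  p. 181 (`C°`).
-/

noncomputable section

namespace Summit.CriticalPhenomena.CardyFormulaZ2.Theorems

open Set
open Literature.Probability.Percolation Literature.Probability.LatticeModels

/-- The local-to-lattice face maps are injective. [folklore] -/
theorem localToHex_injective (x₀ : Site 2) : Function.Injective (localToHex x₀) := by
  rintro ⟨a, b, t⟩ ⟨a', b', t'⟩ h
  simp only [localToHex, Prod.mk.injEq, add_right_inj] at h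
  obtain ⟨h1, h2⟩ := h
  have ha : a = a' := by simpa using congr_fun h1 0
  have hb : b = b' := by simpa using congr_fun h1 1
  subst ha hb h2
  rfl

/-- The local-to-lattice face maps (negative mesh) are injective. [folklore] -/
theorem localToHexNeg_injective (x₀ : Site 2) : Function.Injective (localToHexNeg x₀) := by
  rintro ⟨a, b, t⟩ ⟨a', b', t'⟩ h
  simp only [localToHexNeg, Prod.mk.injEq, add_right_inj] at h
  obtain ⟨h1, h2⟩ := h
  have ha : a = a' := by have := congr_fun h1 0; simp at this; linarith
  have hb : b = b' := by have := congr_fun h1 1; simp at this; linarith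
  have ht : t = t' := by
    fin_cases t <;> fin_cases t' <;> simp at h2 ⊢
  subst ha hb ht
  rfl

/-! ### The faces inside a lattice triangular contour, as faces of `δ𝕋` -/

/-- A point of a solid triangle `PQR` is `P + α (Q - P) + β (R - P)` with `α, β ≥ 0`,
`α + β ≤ 1`. [folklore] -/
theorem exists_coeffs_of_mem_convexHull_triple {P Q R q : ℂ}
    (h : q ∈ convexHull ℝ ({P, Q, R} : Set ℂ)) :
    ∃ α β : ℝ, 0 ≤ α ∧ 0 ≤ β ∧ α + β ≤ 1 ∧ q = P + α * (Q - P) + β * (R - P) := by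
  rw [convexHull_insert ⟨Q, by simp⟩, convexJoin_singleton_left] at h
  obtain ⟨y, hy, hq⟩ := Set.mem_iUnion₂.1 h
  rw [convexHull_pair, segment_eq_image'] at hy
  obtain ⟨μ, hμ, rfl⟩ := hy
  rw [segment_eq_image'] at hq
  obtain ⟨θ, hθ, rfl⟩ := hq
  refine ⟨θ * (1 - μ), θ * μ, mul_nonneg hθ.1 (by linarith [hμ.2]), mul_nonneg hθ.1 hμ.1,
    by nlinarith [hθ.2], ?_⟩
  simp only [Complex.real_smul]
  push_cast
  ring

/-- **Lattice coordinates of a site of `δ𝕋` in the closed solid triangle of a contour** with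
corner `triMeshPoint δ x₀`, `n` edges per side and signed mesh `s = σ δ` (`σ = ±1`, `δ > 0`):
writing `y - x₀ = (A, B)`, one has `σA, σB ≥ 0` and `σ(A + B) ≤ n`. [folklore] -/
theorem coords_of_triMeshPoint_mem_convexHull {δ : ℝ} (hδ : 0 < δ) (x₀ y : Site 2) (n : ℕ)
    {σ : ℝ} (hσ : σ = 1 ∨ σ = -1)
    (h : triMeshPoint δ y ∈ convexHull ℝ ({triMeshPoint δ x₀, triMeshPoint δ x₀ + n * ((σ * δ : ℝ) : ℂ),
      triMeshPoint δ x₀ + n * ((σ * δ : ℝ) : ℂ) * triZeta} : Set ℂ)) :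
    0 ≤ σ * ((y 0 : ℝ) - x₀ 0) ∧ 0 ≤ σ * ((y 1 : ℝ) - x₀ 1) ∧
      σ * (((y 0 : ℝ) - x₀ 0) + ((y 1 : ℝ) - x₀ 1)) ≤ n := by
  obtain ⟨α, β, hα, hβ, hαβ, hq⟩ := exists_coeffs_of_mem_convexHull_triple h
  -- the equation `δ (A + B ζ) = n σ δ (α + β ζ)`
  have hA : ((y 0 : ℝ) - x₀ 0 : ℝ) = ((y - x₀) 0 : ℤ) := by push_cast [Pi.sub_apply]; ring
  have hB : ((y 1 : ℝ) - x₀ 1 : ℝ) = ((y - x₀) 1 : ℤ) := by push_cast [Pi.sub_apply]; ring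
  have he : (δ : ℂ) * ((((y - x₀) 0 : ℤ) : ℂ) + (((y - x₀) 1 : ℤ) : ℂ) * triZeta) =
      (δ : ℂ) * ((n * σ * α : ℝ) + (n * σ * β : ℝ) * triZeta) := by
    have h1 : triMeshPoint δ y - triMeshPoint δ x₀ = (δ : ℂ) * triEmbed (y - x₀) := by
      simp only [triMeshPoint, triEmbed_sub]; ring
    have h2 : triEmbed (y - x₀) = (((y - x₀) 0 : ℤ) : ℂ) + (((y - x₀) 1 : ℤ) : ℂ) * triZeta := rfl
    rw [← h2, ← h1, hq]
    push_cast
    ring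
  have hδ' : (δ : ℂ) ≠ 0 := by exact_mod_cast hδ.ne'
  have he' := mul_left_cancel₀ hδ' he
  have him := congrArg Complex.im he'
  have hre := congrArg Complex.re he'
  simp only [Complex.add_im, Complex.mul_im, Complex.intCast_re, Complex.intCast_im,
    Complex.ofReal_re, Complex.ofReal_im, triZeta_re, triZeta_im, zero_mul, add_zero,
    zero_add, Complex.add_re, Complex.mul_re, sub_zero] at him hre
  have h3 : Real.sqrt 3 ≠ 0 := (Real.sqrt_pos.2 (by norm_num)).ne'
  have hBeq : (((y - x₀) 1 : ℤ) : ℝ) = n * σ * β := by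
    field_simp at him
    linarith
  have hAeq : (((y - x₀) 0 : ℤ) : ℝ) = n * σ * α := by
    rw [hBeq] at hre
    linarith
  have hσ2 : σ * σ = 1 := by rcases hσ with rfl | rfl <;> norm_num
  have hn : (0 : ℝ) ≤ n := n.cast_nonneg
  rw [hA, hB, hAeq, hBeq]
  refine ⟨?_, ?_, ?_⟩
  · have : σ * (n * σ * α) = n * α := by linear_combination (n * α) * hσ2
    rw [this]; positivity
  · have : σ * (n * σ * β) = n * β := by linear_combination (n * β) * hσ2
    rw [this]; positivity
  · have : σ * (n * σ * α + n * σ * β) = n * (α + β) := by linear_combination (n * (α + β)) * hσ2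
    rw [this]; nlinarith

/-- **Every face of `δ𝕋` whose three vertices lie in the closed solid triangle of a contour
with positive mesh is a face of `C°`** (local coordinates `(x - x₀, t)`). [cite: BollobasRiordan2006, Ch. 7 p. 181] -/
theorem exists_localToHex_of_vertices {δ : ℝ} (hδ : 0 < δ) (x₀ : Site 2) (n : ℕ) (w : HexVertex)
    (hw : ∀ v ∈ hexFaceVertices w, triMeshPoint δ v ∈ convexHull ℝ ({triMeshPoint δ x₀,
      triMeshPoint δ x₀ + n * (δ : ℂ), triMeshPoint δ x₀ + n * (δ : ℂ) * triZeta} : Set ℂ)) :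
    ∃ κ ∈ localInterior n, localToHex x₀ κ = w := by
  obtain ⟨x, t⟩ := w
  have hull_eq : ({triMeshPoint δ x₀, triMeshPoint δ x₀ + n * (δ : ℂ),
      triMeshPoint δ x₀ + n * (δ : ℂ) * triZeta} : Set ℂ) = {triMeshPoint δ x₀,
        triMeshPoint δ x₀ + n * (((1 : ℝ) * δ : ℝ) : ℂ),
        triMeshPoint δ x₀ + n * (((1 : ℝ) * δ : ℝ) : ℂ) * triZeta} := by rw [one_mul]
  rw [hull_eq] at hw
  have hc := fun v hv => coords_of_triMeshPoint_mem_convexHull hδ x₀ v n (Or.inl rfl) (hw v hv)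
  refine ⟨(x 0 - x₀ 0, x 1 - x₀ 1, t), ?_, ?_⟩
  · rw [mem_localInterior]
    simp only
    fin_cases t
    · have h0 := hc x (mem_hexFaceVertices_zero.2 (Or.inl rfl))
      have h1 := hc (x + Pi.single 0 1) (mem_hexFaceVertices_zero.2 (Or.inr (Or.inl rfl)))
      simp only [one_mul, Pi.add_apply, Pi.single_eq_same, Pi.single_eq_of_ne (one_ne_zero),
        Int.cast_add, Int.cast_one, add_zero, Fin.isValue] at h0 h1
      refine ⟨?_, ?_, ?_⟩
      · exact_mod_cast h0.1
      · exact_mod_cast h0.2.1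
      · have : ((x 0 : ℝ) - x₀ 0) + ((x 1 : ℝ) - x₀ 1) + 1 ≤ n := by linarith [h1.2.2]
        simp only [Fin.isValue, Nat.cast_zero, add_zero]
        exact_mod_cast this
    · have h1 := hc (x + Pi.single 0 1) (mem_hexFaceVertices_one.2 (Or.inl rfl))
      have h2 := hc (x + Pi.single 1 1) (mem_hexFaceVertices_one.2 (Or.inr (Or.inl rfl)))
      have h3 := hc (x + (Pi.single 0 1 + Pi.single 1 1))
        (mem_hexFaceVertices_one.2 (Or.inr (Or.inr rfl)))
      simp only [one_mul, Pi.add_apply, Pi.single_eq_same, Pi.single_eq_of_ne (one_ne_zero),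
        Pi.single_eq_of_ne (zero_ne_one), Int.cast_add, Int.cast_one, add_zero,
        zero_add, Fin.isValue] at h1 h2 h3
      refine ⟨?_, ?_, ?_⟩
      · exact_mod_cast h2.1
      · exact_mod_cast h1.2.1
      · have : ((x 0 : ℝ) - x₀ 0) + ((x 1 : ℝ) - x₀ 1) + 1 + 1 ≤ n := by linarith [h3.2.2]
        simp only [Fin.isValue, Nat.cast_one]
        exact_mod_cast this
  · simp only [localToHex, Prod.mk.injEq, and_true]
    funext k
    fin_cases k <;> simp

/-- The same for the negative mesh `s = -δ` and the local coordinates `localToHexNeg`. [cite: BollobasRiordan2006, Ch. 7 p. 181] -/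
theorem exists_localToHexNeg_of_vertices {δ : ℝ} (hδ : 0 < δ) (x₀ : Site 2) (n : ℕ) (w : HexVertex)
    (hw : ∀ v ∈ hexFaceVertices w, triMeshPoint δ v ∈ convexHull ℝ ({triMeshPoint δ x₀,
      triMeshPoint δ x₀ + n * ((-δ : ℝ) : ℂ), triMeshPoint δ x₀ + n * ((-δ : ℝ) : ℂ) * triZeta} : Set ℂ)) :
    ∃ κ ∈ localInterior n, localToHexNeg x₀ κ = w := by
  obtain ⟨x, t⟩ := w
  have hull_eq : ({triMeshPoint δ x₀, triMeshPoint δ x₀ + n * ((-δ : ℝ) : ℂ),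
      triMeshPoint δ x₀ + n * ((-δ : ℝ) : ℂ) * triZeta} : Set ℂ) = {triMeshPoint δ x₀,
        triMeshPoint δ x₀ + n * (((-1 : ℝ) * δ : ℝ) : ℂ),
        triMeshPoint δ x₀ + n * (((-1 : ℝ) * δ : ℝ) : ℂ) * triZeta} := by rw [neg_one_mul]
  rw [hull_eq] at hw
  have hc := fun v hv => coords_of_triMeshPoint_mem_convexHull hδ x₀ v n (Or.inr rfl) (hw v hv)
  refine ⟨(x₀ 0 - x 0 - 1, x₀ 1 - x 1 - 1, 1 - t), ?_, ?_⟩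
  · rw [mem_localInterior]
    simp only
    fin_cases t
    · have h0 := hc x (mem_hexFaceVertices_zero.2 (Or.inl rfl))
      have h1 := hc (x + Pi.single 0 1) (mem_hexFaceVertices_zero.2 (Or.inr (Or.inl rfl)))
      have h2 := hc (x + Pi.single 1 1) (mem_hexFaceVertices_zero.2 (Or.inr (Or.inr rfl)))
      simp only [neg_mul, one_mul, Pi.add_apply, Pi.single_eq_same, Pi.single_eq_of_ne (one_ne_zero),
        Pi.single_eq_of_ne (zero_ne_one), Int.cast_add, Int.cast_one, add_zero,
        Fin.isValue, neg_nonneg, neg_le] at h0 h1 h2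
      refine ⟨?_, ?_, ?_⟩
      · have : (0 : ℝ) ≤ (x₀ 0 : ℝ) - x 0 - 1 := by linarith [h1.1]
        exact_mod_cast this
      · have : (0 : ℝ) ≤ (x₀ 1 : ℝ) - x 1 - 1 := by linarith [h2.2.1]
        exact_mod_cast this
      · have : ((x₀ 0 : ℝ) - x 0 - 1) + ((x₀ 1 : ℝ) - x 1 - 1) + 1 + 1 ≤ n := by linarith [h0.2.2]
        norm_num
        exact_mod_cast this
    · have h1 := hc (x + Pi.single 0 1) (mem_hexFaceVertices_one.2 (Or.inl rfl))
      have h2 := hc (x + Pi.single 1 1) (mem_hexFaceVertices_one.2 (Or.inr (Or.inl rfl)))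
      simp only [neg_mul, one_mul, Pi.add_apply, Pi.single_eq_same, Pi.single_eq_of_ne (one_ne_zero),
        Pi.single_eq_of_ne (zero_ne_one), Int.cast_add, Int.cast_one, add_zero,
        Fin.isValue, neg_nonneg, neg_le] at h1 h2
      refine ⟨?_, ?_, ?_⟩
      · have : (0 : ℝ) ≤ (x₀ 0 : ℝ) - x 0 - 1 := by linarith [h1.1]
        exact_mod_cast this
      · have : (0 : ℝ) ≤ (x₀ 1 : ℝ) - x 1 - 1 := by linarith [h2.2.1]
        exact_mod_cast this
      · have : ((x₀ 0 : ℝ) - x 0 - 1) + ((x₀ 1 : ℝ) - x 1 - 1) + 1 ≤ n := by linarith [h1.2.2]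
        norm_num
        exact_mod_cast this
  · simp only [localToHexNeg, Prod.mk.injEq]
    constructor
    · funext k
      fin_cases k <;> simp
    · fin_cases t <;> simp


end Summit.CriticalPhenomena.CardyFormulaZ2.Theorems

end
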